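import Literature.Algebra.Homology.BaseChangeComplexReprModuleResidueField
import HarnessLib

/-!
# `H¹(k ⊗_R (R ⊗_A K•)) ≅ H¹(k ⊗_A K•)`: the degree-one cohomology of an iterated base change is that of the composite base change
# ([AtiyahMacdonald1969] Prop. 2.14 / Ex. 2.20; [MumfordAV1970] §5 Lemma 1)

Layer `Literature/Algebra/Homology`, namespace `Literature.Algebra.Homology`.  THEOREMS ONLY (no definition, no named fact, no instance, no notation,
no `sorry`), over ★ `BaseChangeComplex`, ★ `FreeComplexDoubleDualBaseChange` §1 (transport of `H¹` in the map-`mkQ` spelling along degreewise isomorphisms)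
and ★ `BaseChangeComplexReprModuleResidueField` §1 (`cancelBaseChange` intertwines the differentials).  Cell `hodgecm-mathlib` (D-0151), junction (J10-i) of the
«H1-DIM-ANY-CHAR cut» (B-p04 memo v3 §2): the entry point ★ `finrank_HOne_baseChangeComplex_residueField_eq_finrank_cotangentSpace` speaks of
`H¹(k ⊗_R K•_R)` for `K•_R = baseChangeComplex R K•` (the Grothendieck complex base-changed to the local ring `R = 𝒪_{Â,0̂}`), while the Čech side
(affine base change of the module Čech complex to the `k`-point `0̂`) speaks of `k ⊗_A K•`; this file identifies the two `H¹` (map-`mkQ` spelling of ★ B3).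

* `nonempty_HOne_baseChangeComplex_tower_linearEquiv` — for an `A`-algebra tower `A → R → k` (any commutative `k`) and any cochain complex `K•` of `A`-modules:
  `H¹(baseChangeComplex k (baseChangeComplex R K•)) ≃ₗ[k] H¹(baseChangeComplex k K•)`;
* `finrank_HOne_baseChangeComplex_tower_eq` — hence equal `finrank` over `k`.

HC_CM is proved only modulo the 7 printed citations until rung 0 closes; nothing here bears on a summit statement (count-neutral capital).

## References
* [AtiyahMacdonald1969] M. F. Atiyah, I. G. Macdonald, *Introduction to Commutative Algebra* (1969), Prop. 2.14 and Ex. 2.20 (p. 31).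
* [MumfordAV1970] D. Mumford, *Abelian Varieties* (1970), §5 Lemma 1 (p. 47), §13 (pp. 127–129).
* [Weibel1994] C. A. Weibel, *An introduction to homological algebra* (1994), §1.1 (p. 2).
-/

set_option autoImplicit false

universe u

open TensorProduct

noncomputable section

namespace Literature.Algebra.Homology

variable {A R : Type u} [CommRing A] [CommRing R] [Algebra A R] (k : Type u) [CommRing k] [Algebra R k] [Algebra A k] [IsScalarTower A R k]
  (K : CochainComplex (ModuleCat.{u} A) ℤ)

/-- **`H¹(k ⊗_R (R ⊗_A K•)) ≃ₗ[k] H¹(k ⊗_A K•)`** (map-`mkQ` spelling): the degreewise isomorphisms `k ⊗_R (R ⊗_A Kⁱ) ≅ k ⊗_A Kⁱ` (Mathlib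
`cancelBaseChange`) intertwine the differentials (★ `cancelBaseChange_lTensor_baseChange`), so ★ `nonempty_HOne_linearEquiv_of_comm` applies.
[cite: AtiyahMacdonald1969, Prop. 2.14 and Ex. 2.20 (p. 31)] [cite: Weibel1994, §1.1 (p. 2)] -/
theorem nonempty_HOne_baseChangeComplex_tower_linearEquiv :
    Nonempty (↥((LinearMap.ker ((baseChangeComplex k (baseChangeComplex R K)).d 1 2).hom).map
        (LinearMap.range ((baseChangeComplex k (baseChangeComplex R K)).d 0 1).hom).mkQ) ≃ₗ[k]
      ↥((LinearMap.ker ((baseChangeComplex k K).d 1 2).hom).map (LinearMap.range ((baseChangeComplex k K).d 0 1).hom).mkQ)) := by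
  have hcomm : ∀ (i j : ℤ) (x : k ⊗[R] (R ⊗[A] K.X i)),
      AlgebraTensorModule.cancelBaseChange A R k k (K.X j) (((baseChangeComplex k (baseChangeComplex R K)).d i j).hom x) =
        ((baseChangeComplex k K).d i j).hom (AlgebraTensorModule.cancelBaseChange A R k k (K.X i) x) := by
    intro i j x
    change AlgebraTensorModule.cancelBaseChange A R k k (K.X j) ((((K.d i j).hom.baseChange R).baseChange k) x) =
      (K.d i j).hom.baseChange k (AlgebraTensorModule.cancelBaseChange A R k k (K.X i) x)
    rw [LinearMap.baseChange_eq_ltensor]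
    exact cancelBaseChange_lTensor_baseChange (K.d i j).hom k x
  exact nonempty_HOne_linearEquiv_of_comm (S := k)
    ((baseChangeComplex k (baseChangeComplex R K)).d 0 1).hom ((baseChangeComplex k (baseChangeComplex R K)).d 1 2).hom
    ((baseChangeComplex k K).d 0 1).hom ((baseChangeComplex k K).d 1 2).hom
    (AlgebraTensorModule.cancelBaseChange A R k k (K.X 0)) (AlgebraTensorModule.cancelBaseChange A R k k (K.X 1))
    (AlgebraTensorModule.cancelBaseChange A R k k (K.X 2)) (hcomm 0 1) (hcomm 1 2)

/-- **`finrank_k H¹(k ⊗_R (R ⊗_A K•)) = finrank_k H¹(k ⊗_A K•)`** (map-`mkQ` spelling).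
[cite: AtiyahMacdonald1969, Prop. 2.14 and Ex. 2.20 (p. 31)] [cite: MumfordAV1970, §5 Lemma 1 (p. 47)] -/
theorem finrank_HOne_baseChangeComplex_tower_eq :
    Module.finrank k ↥((LinearMap.ker ((baseChangeComplex k (baseChangeComplex R K)).d 1 2).hom).map
        (LinearMap.range ((baseChangeComplex k (baseChangeComplex R K)).d 0 1).hom).mkQ) =
      Module.finrank k ↥((LinearMap.ker ((baseChangeComplex k K).d 1 2).hom).map (LinearMap.range ((baseChangeComplex k K).d 0 1).hom).mkQ) := by
  obtain ⟨e⟩ := nonempty_HOne_baseChangeComplex_tower_linearEquiv (R := R) k K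
  exact e.finrank_eq

end Literature.Algebra.Homology

end
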